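import Mathlib
import Literature.Analysis.FluidPDE.Tao2016AveragedNS.CascadeTableDictionary
import Literature.Analysis.FluidPDE.Tao2016AveragedNS.GlobalWellposedness
import Literature.Analysis.FluidPDE.Tao2016AveragedNS.SelfSimilarCascadeResidues
import HarnessLib

/-!
# The exact TWO-SHELL FLOW of a cancelling table: the energy-neutral field
  `(x, y) ↦ (Q x + B(y, x), Λ₁ Q y + A x)` has a global trajectory from every `(X₀, 0)`, and the lattice family it
  generates on shells `0, 1` obeys the exact law (4.8)/(4.12) on every shell EXCEPT for the feed `Λ₁ A(y)` into shell
  `2` (tool file for the one-hop corner of K2(1) `TaoLadderRungTwoBreak.BlowupRigidityOne`,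
  stmt-NavierStokesRegularity-20206; `--supports`)

MODEL lattice ODEs only (Tao 2016 §4 (4.1)–(4.3), Lemma 4.1 (4.8), (4.12); §5 (ode)–(g-cancel), p. 25); nothing here
is a statement about the Navier–Stokes equations; NO item is closed.  DEF-FREE (the two-shell field and family are
written out as lambdas); ROUTE-INDEPENDENT MODULE (no `Theses` import).

* `exists_solution_of_sum_mul_eq_zero` — the tree's global well-posedness of cancelling quadratic circuits
  (`IsCancelling.exists_solution`, `energy_eq_of_isCancelling`: "the flow preserves the norm", Tao §5 p. 25)
  transported from `Fin N` to any finite index type, with the amplitude bound `|Z_s(t)| ≤ √(Σ z₀²)`;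
* `inner_eq_sum_mul`, `sum_twoShellField_mul_eq_zero`, `contDiff_twoShellField` — on `ℝ^m ⊕ ℝ^m` the TWO-SHELL
  field `(x, y) ↦ (Q x + B(y, x), Λ₁ Q y + A x)` (shells `0` and `1` of the exact lattice with every other shell
  frozen at `0`; any `Λ₁`) is energy-neutral for EVERY cancelling table (`table_sTable`: `⟪x,Qx⟫ = 0`,
  `⟪x,B(y,x)⟫ + ⟪y,Ax⟫ = 0`) and `C¹` — so it flows globally;
* `table_maps_zero`, `shellVec_twoShell`, `quadTerm_twoShell` — the cascade nonlinearity (4.8) on the two-shell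
  family `X_{·,0} = x`, `X_{·,1} = y`, `X_{·,n} = 0` else: `Q x + B(y,x)` on shell `0`, `(1+ε₀)^{5/2} Q y + A x` on
  shell `1`, the FEED `(1+ε₀)^{5/2} A(y)` on shell `2`, and `0` on every other shell (`quadTerm_eq_tables`).  The
  two-shell flow is an exact lattice flow iff shell `1` never emits (`A(y(t)) = 0`) — the one-hop corner of the
  sibling file `…BlowupRigidityOneOneHopTables`.

HONEST LABEL: tool lemmas; no stub, crux, rung or summit is proved; rung 0.
-/

noncomputable section

-- the summit and its single sub-problem share the name (CONVENTIONS §1)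
set_option linter.dupNamespace false

open Set Filter Topology MeasureTheory
open scoped RealInnerProductSpace

namespace Summit.NavierStokesRegularity.NavierStokesRegularity.Theorems

namespace BlowupRigidityOne

open Literature.Analysis.FluidPDE Literature.Analysis.FluidPDE.TaoCascade
  Literature.Analysis.FluidPDE.Tao2016AveragedNS

variable {m : ℕ} {R ε₀ : ℝ} {α : Fin m → Fin m → Fin m → ℤ × ℤ × ℤ → ℝ}

/-! ## Global solutions of energy-neutral smooth fields on any finite index type -/

/-- **Cancelling smooth fields flow globally (any finite index type), with the energy bound.**  If
`G : (ι → ℝ) → (ι → ℝ)` is `C¹` with `Σ_s G(Z)_s Z_s = 0`, then through every `z₀` there is a global trajectory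
`Z : ℝ → (ι → ℝ)`, `Z(0) = z₀`, `Z' = G(Z)`, with `|Z_s(t)| ≤ √(Σ_r z₀_r²)` for all `t, s` — the tree's
`IsCancelling.exists_solution` / `energy_eq_of_isCancelling` (Tao §5: "the flow preserves the norm") transported
along `ι ≃ Fin (card ι)`.
[cite: Tao2016AveragedNS, §5 (ode)–(g-cancel), p. 25; Teschl2012, Cor. 2.16] -/
theorem exists_solution_of_sum_mul_eq_zero {ι : Type} [Fintype ι] (G : (ι → ℝ) → (ι → ℝ))
    (hG : ∀ Z : ι → ℝ, ∑ s, G Z s * Z s = 0) (hG' : ContDiff ℝ 1 G) (z₀ : ι → ℝ) :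
    ∃ Z : ℝ → ι → ℝ, Z 0 = z₀ ∧ (∀ t, HasDerivAt Z (G (Z t)) t) ∧
      ∀ t s, |Z t s| ≤ Real.sqrt (∑ r, z₀ r ^ 2) := by
  classical
  set e := Fintype.equivFin ι with he
  set F : (Fin (Fintype.card ι) → ℝ) → (Fin (Fintype.card ι) → ℝ) :=
    fun W => fun j => G (fun i => W (e i)) (e.symm j) with hF
  have hFc : IsCancelling F := by
    intro W
    have h := hG (fun i => W (e i))
    rw [← Equiv.sum_comp e.symm (fun i => G (fun i => W (e i)) i * (fun i => W (e i)) i)] at h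
    simpa [hF] using h
  have hF' : ContDiff ℝ 1 F := by
    refine contDiff_pi.2 fun j => ?_
    have h1 : ContDiff ℝ 1 (fun W : Fin (Fintype.card ι) → ℝ => fun i => W (e i)) :=
      contDiff_pi.2 fun i => contDiff_apply ℝ ℝ (e i)
    exact (contDiff_apply ℝ ℝ (e.symm j)).comp (hG'.comp h1)
  obtain ⟨W, hW0, hW⟩ := hFc.exists_solution hF' (fun j => z₀ (e.symm j))
  refine ⟨fun t i => W t (e i), ?_, fun t => ?_, fun t s => ?_⟩
  · funext i
    show W 0 (e i) = z₀ i
    rw [hW0]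
    simp
  · refine hasDerivAt_pi.2 fun i => ?_
    have h := (hasDerivAt_pi.1 (hW t)) (e i)
    simpa [hF] using h
  · have hb := abs_apply_le_sqrt_energy (W t) (e s)
    rw [energy_eq_of_isCancelling hFc hW t 0, hW0] at hb
    refine hb.trans (le_of_eq ?_)
    unfold energy
    rw [← Equiv.sum_comp e.symm (fun r => z₀ r ^ 2)]

/-! ## The two-shell field of a cancelling table -/

/-- Real inner products on `ℝ^m` as coordinate sums. [elementary] -/
theorem inner_eq_sum_mul (u v : Em m) : ⟪u, v⟫ = ∑ i, u i * v i := by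
  simp [PiLp.inner_apply, mul_comm]

/-- **The two-shell field is energy-neutral.**  For a cancelling table and any `Λ₁`, on `ℝ^m ⊕ ℝ^m` the field
`(x, y) ↦ (Q x + B(y, x), Λ₁ Q y + A x)` (shell `0` driven by its rotor and the back-reaction of shell `1`, shell `1`
by its rotor and the outflow of shell `0`) satisfies `Σ_s G(Z)_s Z_s = ⟪x, Qx⟫ + ⟪x, B(y,x)⟫ + Λ₁⟪y, Qy⟫ + ⟪y, Ax⟫ = 0`
(`table_sTable`: intra-shell neutrality and the type-split cancellation).
[cite: Tao2016AveragedNS, §4 (4.3), Lemma 4.1 (4.8); §5 (g-cancel)] -/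
theorem sum_twoShellField_mul_eq_zero (hc : IsCancellingCoeff α) (Λ₁ : ℝ) (Z : Fin m ⊕ Fin m → ℝ) :
    ∑ s, (Sum.elim
        (fun i => (tableQ α (WithLp.toLp 2 fun j => Z (Sum.inl j)) +
          tableB α (WithLp.toLp 2 fun j => Z (Sum.inr j)) (WithLp.toLp 2 fun j => Z (Sum.inl j))) i)
        (fun i => (Λ₁ • tableQ α (WithLp.toLp 2 fun j => Z (Sum.inr j)) +
          tableA α (WithLp.toLp 2 fun j => Z (Sum.inl j))) i) : Fin m ⊕ Fin m → ℝ) s * Z s = 0 := by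
  have hST := table_sTable α hc
  set x : Em m := WithLp.toLp 2 fun j => Z (Sum.inl j) with hx
  set y : Em m := WithLp.toLp 2 fun j => Z (Sum.inr j) with hy
  rw [Fintype.sum_sum_type]
  simp only [Sum.elim_inl, Sum.elim_inr]
  have h1 : ∑ i, (tableQ α x + tableB α y x) i * Z (Sum.inl i) = ⟪x, tableQ α x⟫ + ⟪x, tableB α y x⟫ := by
    rw [inner_eq_sum_mul, inner_eq_sum_mul, ← Finset.sum_add_distrib]
    refine Finset.sum_congr rfl fun i _ => ?_
    simp only [PiLp.add_apply, hx, PiLp.toLp_apply]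
    ring
  have h2 : ∑ i, (Λ₁ • tableQ α y + tableA α x) i * Z (Sum.inr i) =
      Λ₁ * ⟪y, tableQ α y⟫ + ⟪y, tableA α x⟫ := by
    rw [inner_eq_sum_mul, inner_eq_sum_mul, Finset.mul_sum, ← Finset.sum_add_distrib]
    refine Finset.sum_congr rfl fun i _ => ?_
    simp only [PiLp.add_apply, PiLp.smul_apply, smul_eq_mul, hy, PiLp.toLp_apply]
    ring
  rw [h1, h2, hST.intra x, hST.intra y]
  have hcancel := hST.cancel x y
  linarith

/-- The two-shell field is a polynomial, hence `C¹`, vector field on `ℝ^m ⊕ ℝ^m`. [folklore] -/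
theorem contDiff_twoShellField (α : Fin m → Fin m → Fin m → ℤ × ℤ × ℤ → ℝ) (Λ₁ : ℝ) :
    ContDiff ℝ 1 (fun Z : Fin m ⊕ Fin m → ℝ => (Sum.elim
        (fun i => (tableQ α (WithLp.toLp 2 fun j => Z (Sum.inl j)) +
          tableB α (WithLp.toLp 2 fun j => Z (Sum.inr j)) (WithLp.toLp 2 fun j => Z (Sum.inl j))) i)
        (fun i => (Λ₁ • tableQ α (WithLp.toLp 2 fun j => Z (Sum.inr j)) +
          tableA α (WithLp.toLp 2 fun j => Z (Sum.inl j))) i) : Fin m ⊕ Fin m → ℝ)) := by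
  refine contDiff_pi.2 fun s => ?_
  rcases s with i | i
  · simp only [Sum.elim_inl, PiLp.add_apply, tableQ_apply, tableB_apply, qform]
    fun_prop
  · simp only [Sum.elim_inr, PiLp.add_apply, PiLp.smul_apply, smul_eq_mul, tableQ_apply, tableA_apply, qform]
    fun_prop

/-! ## The two-shell family and its nonlinearity -/

/-- `A(0) = 0`, `Q(0) = 0`, `B(y, 0) = 0`, `B(0, x) = 0` for the table maps (bilinear forms).
[cite: Tao2016AveragedNS, §4 (4.1); cell vocabulary (`tableQ`, `tableA`, `tableB`)] -/
theorem table_maps_zero (α : Fin m → Fin m → Fin m → ℤ × ℤ × ℤ → ℝ) (x y : Em m) :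
    tableA α 0 = 0 ∧ tableQ α 0 = 0 ∧ tableB α y 0 = 0 ∧ tableB α 0 x = 0 := by
  refine ⟨?_, ?_, ?_, ?_⟩ <;> ext i <;>
    simp [tableA_apply, tableQ_apply, tableB_apply, qform]

/-- Shell vectors of the two-shell family `X_{·,0} = x`, `X_{·,1} = y`, `X_{·,n} = 0` (`n ≠ 0, 1`).
[cite: Tao2016AveragedNS, §4 Lemma 4.1 (amplitudes of one shell); cell vocabulary (`shellVec`)] -/
theorem shellVec_twoShell (x y : ℝ → Fin m → ℝ) (k : ℤ) (t : ℝ) :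
    shellVec (fun i k t => if k = 0 then x t i else if k = 1 then y t i else 0) k t =
      if k = 0 then WithLp.toLp 2 (x t) else if k = 1 then WithLp.toLp 2 (y t) else 0 := by
  ext i
  simp only [shellVec_apply]
  split_ifs <;> simp

/-- **The exact nonlinearity on the two-shell family.**  With `x_t, y_t` the shell vectors of shells `0, 1` and all
other shells `0`: `quadTerm_{i,0} = (Q x + B(y,x))_i`, `quadTerm_{i,1} = ((1+ε₀)^{5/2} Q y + A x)_i`,
`quadTerm_{i,2} = (1+ε₀)^{5/2}(A y)_i`, and `quadTerm_{i,n} = 0` for `n ∉ {0,1,2}` (`quadTerm_eq_tables`).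
[cite: Tao2016AveragedNS, §4 (4.1), Lemma 4.1 (4.8), (4.12)] -/
theorem quadTerm_twoShell (ε₀ : ℝ) (α : Fin m → Fin m → Fin m → ℤ × ℤ × ℤ → ℝ) (x y : ℝ → Fin m → ℝ)
    (i : Fin m) (n : ℤ) (t : ℝ) :
    quadTerm ε₀ α (fun i k t => if k = 0 then x t i else if k = 1 then y t i else 0) i n t =
      if n = 0 then (tableQ α (WithLp.toLp 2 (x t)) + tableB α (WithLp.toLp 2 (y t)) (WithLp.toLp 2 (x t))) i
      else if n = 1 then
        ((1 + ε₀) ^ ((5 : ℝ) / 2) • tableQ α (WithLp.toLp 2 (y t)) + tableA α (WithLp.toLp 2 (x t))) i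
      else if n = 2 then (1 + ε₀) ^ ((5 : ℝ) / 2) * tableA α (WithLp.toLp 2 (y t)) i
      else 0 := by
  have hA0 : tableA α (0 : Em m) = 0 := (table_maps_zero α 0 0).1
  have hQ0 : tableQ α (0 : Em m) = 0 := (table_maps_zero α 0 0).2.1
  have hBv0 : ∀ v : Em m, tableB α v 0 = 0 := fun v => (table_maps_zero α v v).2.2.1
  have hB0v : ∀ v : Em m, tableB α 0 v = 0 := fun v => (table_maps_zero α v v).2.2.2
  rw [quadTerm_eq_tables, shellVec_twoShell, shellVec_twoShell, shellVec_twoShell]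
  by_cases h0 : n = 0
  · subst h0
    simp only [if_true, zero_add, one_ne_zero, if_false, show ((0 : ℤ) - 1 = 0) ↔ False by decide,
      show ((0 : ℤ) - 1 = 1) ↔ False by decide, hA0, PiLp.zero_apply, mul_zero, add_zero, PiLp.add_apply,
      Int.cast_zero]
    norm_num
  by_cases h1 : n = 1
  · subst h1
    simp only [if_true, one_ne_zero, if_false, show ((1 : ℤ) + 1 = 0) ↔ False by decide,
      show ((1 : ℤ) + 1 = 1) ↔ False by decide, sub_self, hB0v, PiLp.zero_apply, mul_zero, add_zero,
      PiLp.add_apply, PiLp.smul_apply, smul_eq_mul, Int.cast_one]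
    norm_num
  by_cases h2 : n = 2
  · subst h2
    simp only [show ((2 : ℤ) = 0) ↔ False by decide, show ((2 : ℤ) = 1) ↔ False by decide, if_false,
      show ((2 : ℤ) + 1 = 0) ↔ False by decide, show ((2 : ℤ) + 1 = 1) ↔ False by decide,
      show ((2 : ℤ) - 1 = 0) ↔ False by decide, show ((2 : ℤ) - 1 = 1) ↔ True by decide, if_true,
      hQ0, hB0v, PiLp.zero_apply, mul_zero, zero_add, Int.cast_ofNat]
    norm_num
  · have h5 : ¬ n - 1 = 0 := fun h => h1 (by omega)
    have h6 : ¬ n - 1 = 1 := fun h => h2 (by omega)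
    simp only [h0, h1, h2, h5, h6, if_false, hQ0, hA0, PiLp.zero_apply, mul_zero, add_zero, zero_add]
    -- the `(1,0,0)/(0,1,0)` block `B(x_{n+1}, 0) = 0` whatever shell `n+1` holds
    split_ifs <;> simp [hBv0]

end BlowupRigidityOne

end Summit.NavierStokesRegularity.NavierStokesRegularity.Theorems

end
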